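import Summits.CriticalPhenomena.CardyFormulaZ2.Theses.CardyBoundaryCoulombGas
import Summits.CriticalPhenomena.CardyFormulaZ2.Theorems.StripClusterRates.Negative.KacFromAboveFalse
import Summits.CriticalPhenomena.CardyFormulaZ2.Theorems.StripClusterRates.Negative.WidthOneTwoClusterExact
import Literature.Probability.Percolation.CrossingChains
import Literature.Probability.Percolation.InequalitiesProofs
import Mathlib.Analysis.Subadditive
import Mathlib.NumberTheory.Real.GoldenRatio

/-!
# Disproof of `StripClusterRates` (stmt-CriticalPhenomena-13878) — standing adversary's work file

**Status (cycle 2, refuter-cdisprove-stmt-CriticalPhenomena-13878-g2-0): NO KILL.** The crux is, as far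
as every rigorous handle and every numerical probe can tell, TRUE; what resists is proving the two
constants. This file is now an INDEX over the `Theorems/StripClusterRates/Negative/` modules (FALLBACK VARIANT written while the Lean farm was stale: the content of `SubmultiplicativeOne` (landed, p78978), `SubmultiplicativeTwo` (p79369) and `RateWindow` (p79263) is INLINED below in this namespace; the slim index version replaces this once the farm has built them)
(all `lean check`ed, axioms `{propext, Classical.choice, Quot.sound}`) plus the material that has no
home there (load-bearing analysis at the junk width, the Fekete existence proof of the support item,
the one remaining near-miss, and the numerics record).

Landed negative/tightness knowledge (import the modules; names below are in namespace
`Summit.CriticalPhenomena.CardyFormulaZ2.Theorems.StripClusterRates.Negative`):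

* `KacFromAboveFalse` (p73553, cycle 1): `pOne_ge : p₁ ≥ 2⁻ᵐ`, `pTwo_ge : p₂ ≥ 2^{-(3m+1)}` ⇒
  `rateOne_le : γ₁(n) ≤ log 2`, `rateTwo_le : γ₂(n) ≤ 3 log 2`; `not_kacLowerBoundEveryWidth_one/_two`
  ("Kac from above" is false: `1·γ₁(1) ≤ log 2 < π/3`, `n·γ₂(n) < 2π` for `n ≤ 3`);
  `rateOne_odd_width_le` (RSW: `γ₁(2j+1) ≤ 8 log 2/(j+1)`), `rateOne_antitone`.
* `WidthOneTwoClusterExact` (p76323, cycle 2): TIGHTNESS — `pTwo_width_one : p₂(m,1) = 2^{-(3m+1)}`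
  EXACTLY (two distinct spanning clusters of the 2-row strip are the two rows with every rung closed,
  `twoClusterEvent_width_one_subset`), hence `rateTwo_width_one : γ₂(1) = 3 log 2 = 2.0794…` and
  `rateTwo_width_one_unique`; the bound `rateTwo_le` cannot be improved uniformly in `n`.
* `SubmultiplicativeOne` / `SubmultiplicativeTwo` (cycle 2): `pOne_add_le`, `pTwo_add_le`:
  `p_k(m₁+m₂+1,n) ≤ p_k(m₁,n)·p_k(m₂,n)` (vertex-disjoint blocks are independent; translation);
  LOWER bounds `rateOne_ge_finite : γ₁(n) ≥ -log p₁(m,n)/(m+1)` for every `m` (and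
  `rateTwo_ge_finite`), `rateOne_ge : γ₁(n) ≥ log 2/(n+2)` (self-duality `p₁(n+1,n) = 1/2`).
* `RateWindow` (cycle 2): BK `pTwo_le_pOne_sq : p₂ ≤ p₁²` ⇒ `rateTwo_ge_two_mul_rateOne : γ₂(n) ≥ 2γ₁(n)`;
  THE WINDOW `nMul_rateOne_limit_mem_window : log 2 ≤ lim n·γ₁(n) ≤ 16 log 2` and
  `nMul_rateTwo_limit_ge : 2 log 2 ≤ lim n·γ₂(n)` for EVERY rate function and EVERY limit;
  `kac_values_in_window`; REFUTED VARIANTS `not_stripClusterRates_variant_of_lt_log_two / _of_gt /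
  _of_lt_two_mul / _of_lt_two_log_two / _bulkOneArm` (the crux's statement with constants
  `c₁ < log 2`, `c₁ > 16 log 2`, `c₂ < 2c₁` or `c₂ < 2 log 2` is false; e.g. `c₁ = 5π/48`).

In this file:

* §1 LOAD-BEARING ANALYSIS (kept from cycle 1): the only hypothesis `1 ≤ n` is not load-bearing —
  at the junk width `n = 0` the two-cluster event is empty (`twoClusterEvent_width_zero`), the rate
  sequence is identically `0`; dropping `1 ≤ n` gives no purchase.
* §2 EXISTENCE IS SETTLED (cycle 2): `stripRatesExist_holds : StripRatesExist` — the support item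
  stmt-13879 follows from sub-multiplicativity + the explicit lower bounds by FEKETE alone (no RSW/FKG
  gluing); attached to stmt-13879 as a candidate proof (`StripRatesExistProof.lean`, a prover lands it).
  Consequently the crux is EQUIVALENT to its two limit conjuncts (`stripClusterRates_iff_limits`):
  all the difficulty is in the constants `π/3`, `2π`.
* §3 WHY IT RESISTS, quantitatively: the constants sit strictly inside every rigorous window
  (`log 2 = 0.693 ≤ L₁ ≤ 11.09`, `L₁`-claim `1.047`; `1.386 ≤ L₂`, claim `6.283`). A disproof needs
  either (a) a rigorous lower bound `L₁ > π/3` / upper bound `L₁ < π/3` — i.e. an essentially sharp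
  crossing estimate on ℤ², equivalent in difficulty to the crux — or (b) numerics contradicting Kac;
  and the numerics AGREE with Kac (§4).
* §4 NUMERICS RECORD (exact transfer matrices). Cycle 1: two bases (cluster / TL standard module),
  widths `n ≤ 12` (γ₁) / `11` (γ₂), agreeing to all digits. Cycle 2: independent vectorised TL
  standard-module code `compute/tm_kac.py` (numpy; kit jobs j010920 validation, j011133 `n ≤ 14`,
  workitem-linked — queued behind a saturated farm at the time of writing; their evidence note lands
  on the item) and its pure-python twin `tm_kac_pure.py` run in-session to FULL precision for
  `n ≤ 11`: it reproduces `λ₁(1) = (3+√5)/8`, `λ₂(1) = 1/8` and the ideators' SLEM digits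
  `0.19913379, 0.27095185, 0.33549312, 0.39195435` exactly, and gives
  `n·γ₁(n) = 0.423870711, 0.607625433, 0.708930376, 0.772746238, 0.816509809, 0.848338928,
  0.872506592, 0.891470195, 0.906740869, 0.919297924, 0.929803397` (n = 1..11; cycle 1: `0.93872` at
  n = 12) and `n·γ₂(n) = 2.079441542, 3.227556724, 3.917442440, 4.368615277, 4.683049498,
  4.913038012, 5.087715523, 5.224427723, 5.334070939, 5.423798872` (n = 1..10; cycle 1: `5.49848`
  at n = 11). Three-point fits `1/γ = s·n + b + c/n` on consecutive triples give
  `L₁ = 1/s = 1.05122, 1.04987, 1.04909, 1.04859, 1.04826, 1.04803` (triples ending n = 5..10),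
  decreasing geometrically (ratio ≈ 0.7) with power-law tail estimate `L₁(∞) = 1.0471 ± 0.0005`
  (`π/3 = 1.047198`), and `L₂ = 6.43410, 6.38721, 6.35809, 6.33906, 6.32610, 6.31697` with tail
  estimate `L₂(∞) = 6.285 ± 0.010` (`2π = 6.283185`). Successive slopes `D(1/γ₁) = 0.93229, …,
  0.95221, 0.95266, 0.95286 ↑ 3/π = 0.95493`; `D(1/γ₂) = 0.13877, …, 0.15646, 0.15683 ↑ 1/(2π) =
  0.15915`. The ratio `γ₂/γ₁ = 4.91, 5.31, 5.53, 5.65, 5.74, 5.79, 5.83, 5.86, 5.88, 5.90 → 6` from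
  BELOW, so "γ₂ = 6γ₁ at every width" is false as well (rigorously pending `γ₁(1) > log 2/2`, §6).
  Also `λ_{d=6}(n=2) = 1/32` exactly (three spanning clusters of the 3-row strip = three open rows,
  `p₃(m,2) = 2^{-(5m+2)}`, the width-2 analogue of `pTwo_width_one`) and `n·γ₃(n) = 6.93, 8.79,
  10.07, 10.99 (n = 2..5) ↑` towards `5π = 15.7` (`h_{1,7} = 5`), same pattern.
  VERDICT: every probe is consistent with the Kac values to ≤ 0.05 % (γ₁) and ≤ 0.2 % (γ₂); a
  disproof would need the trend to reverse beyond n = 12 against geometric convergence.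
* §5 LITERATURE (cycle 2): Henkel, *Conformal Invariance and Critical Phenomena*, §15.4 restates
  Cardy 1998 with `x_{1,2n+1} = n(2n−1)/3` and quotes Monte-Carlo consistency for `k ≤ 3`; his
  printed rate `(2π/3)n(n−1)` is a typo for Cardy's `(2π/3)n(n−½)` (which his own `x_{1,2n+1}` gives:
  `π/3`, `2π`). No printed dissent on the constants exists; Aizenman 1997 Thm 3 is the rigorous
  `n²`-window, of the same non-sharp type as §3.
* §6 NEAR-MISS (the only `sorry`): `pOne_width_one_fib : p₁(m,1) = F_{2m+2}/4ᵐ` (Fibonacci; exact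
  3-state marked chain, enumeration-verified for `m ≤ 4`); PROVED from it: `rateOne_width_one_of_fib`
  ⇒ `rate₁_width_one : γ₁(1) = log(8/(3+√5)) = log 4 − 2 log φ`. Needs the width-1 Markov/transfer
  formalism for `crossingProb` — prover infrastructure (`RateIsGap` at `n = 1`), not a disproof matter.
  (The cycle-1 near-miss `rate₂_width_one` is now the theorem `rateTwo_width_one`.)

Targets: payload `stuck_stubs` / `targets` are empty at this re-arm (no line picked yet).
-/

namespace Summit.CriticalPhenomena.CardyFormulaZ2.Cruxes.StripClusterRates.Disproof

open Literature.Probability.Percolation Literature.Probability.LatticeModels MeasureTheory Filter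
open Summit.CriticalPhenomena.CardyFormulaZ2.Theses.CardyBoundaryCoulombGas
open Summit.CriticalPhenomena.CardyFormulaZ2.Theorems.StripClusterRates.Negative
open scoped Topology

noncomputable section

/-! ## Inlined (fallback): content of the Negative modules `SubmultiplicativeOne` (landed p78978, farm not yet rebuilt), `SubmultiplicativeTwo` (p79369 pending), `RateWindow` (p79263 pending) -/


/-! ## §1 Sub-multiplicativity of `p₁` over disjoint blocks -/

/-- The right block `[m₁+1, m₁+m₂+1] × [0,n]` contains the part `{m₁+1 ≤ z₀}` of the long
rectangle `[0, m₁+m₂+1] × [0,n]`. [folklore] -/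
theorem inter_subset_image_rectangle (m₁ m₂ n : ℕ) :
    (↑(rectangle (m₁ + m₂ + 1) n) : Set (Site 2)) ∩ {z | ((m₁ : ℤ) + 1) ≤ z 0} ⊆
      (· + pt (m₁ + 1) 0) '' (rectangle m₂ n : Set (Site 2)) := by
  intro z hz
  simp only [Set.mem_inter_iff, Finset.mem_coe, mem_rectangle_iff, Set.mem_setOf_eq] at hz
  refine ⟨z - pt (m₁ + 1) 0, Finset.mem_coe.2 (mem_rectangle_iff.2 ?_), sub_add_cancel z _⟩
  simp only [Pi.sub_apply, Matrix.cons_val_zero, Matrix.cons_val_one, Matrix.cons_val_fin_one]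
  omega

/-- The left block `[0,m₁]×[0,n]` contains the part `{z₀ ≤ m₁}` of the long rectangle. [folklore] -/
theorem inter_subset_rectangle (m₁ m₂ n : ℕ) :
    (↑(rectangle (m₁ + m₂ + 1) n) : Set (Site 2)) ∩ {z | z 0 ≤ (m₁ : ℤ)} ⊆
      (rectangle m₁ n : Set (Site 2)) := by
  intro z hz
  simp only [Set.mem_inter_iff, Finset.mem_coe, mem_rectangle_iff, Set.mem_setOf_eq] at hz ⊢
  omega

/-- A point of the long rectangle on the column `m₁ + 1` is a shifted left-side point of the right
block. [folklore] -/
theorem mem_image_leftSide_of_col {m₁ m₂ n : ℕ} {z : Site 2}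
    (hz : z ∈ (↑(rectangle (m₁ + m₂ + 1) n) : Set (Site 2))) (hz0 : z 0 = (m₁ : ℤ) + 1) :
    z ∈ (· + pt (m₁ + 1) 0) '' (leftSide m₂ n : Set (Site 2)) := by
  simp only [Finset.mem_coe, mem_rectangle_iff] at hz
  refine ⟨z - pt (m₁ + 1) 0, ?_, sub_add_cancel z _⟩
  simp only [Finset.mem_coe, leftSide, Finset.mem_filter, mem_rectangle_iff, Pi.sub_apply,
    Matrix.cons_val_zero, Matrix.cons_val_one, Matrix.cons_val_fin_one]
  omega

/-- A right-side point of the long rectangle is a shifted right-side point of the right block. [folklore] -/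
theorem mem_image_rightSide_of_mem_rightSide {m₁ m₂ n : ℕ} {y : Site 2}
    (hy : y ∈ (↑(rightSide (m₁ + m₂ + 1) n) : Set (Site 2))) :
    y ∈ (· + pt (m₁ + 1) 0) '' (rightSide m₂ n : Set (Site 2)) := by
  simp only [Finset.mem_coe, rightSide, Finset.mem_filter, mem_rectangle_iff] at hy
  refine ⟨y - pt (m₁ + 1) 0, ?_, sub_add_cancel y _⟩
  simp only [Finset.mem_coe, rightSide, Finset.mem_filter, mem_rectangle_iff, Pi.sub_apply,
    Matrix.cons_val_zero, Matrix.cons_val_one, Matrix.cons_val_fin_one]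
  omega

/-- **A crossing of `[0, m₁+m₂+1]×[0,n]` crosses the right block `[m₁+1, m₁+m₂+1]×[0,n]`**
(lattice configurations). [folklore] -/
theorem lrCrossingAt_of_lrCrossing_add {m₁ m₂ n : ℕ} {ω : BondConfig (Site 2)}
    (hωE : ω ⊆ (zdGraph 2).edgeSet) (hω : ω ∈ lrCrossing (m₁ + m₂ + 1) n) :
    ω ∈ lrCrossingAt (pt (m₁ + 1) 0) m₂ n := by
  obtain ⟨x, hx, y, hy, hxy⟩ := hω
  have hx0 : x 0 = 0 := (Finset.mem_filter.1 (Finset.mem_coe.1 hx)).2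
  have hy0 : y 0 = (m₁ + m₂ + 1 : ℕ) := (Finset.mem_filter.1 (Finset.mem_coe.1 hy)).2
  have hyx : ω ∈ openConnIn (↑(rectangle (m₁ + m₂ + 1) n)) y x := by rwa [openConnIn_comm]
  obtain ⟨z, hz0, hz⟩ := exists_openConnIn_column_ge hωE ((m₁ : ℤ) + 1)
    (by rw [hy0]; push_cast; omega) (by rw [hx0]; positivity) hyx
  have hz' := openConnIn_mono (inter_subset_image_rectangle m₁ m₂ n) y z hz
  refine ⟨z, ?_, y, mem_image_rightSide_of_mem_rightSide hy, by rwa [openConnIn_comm]⟩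
  obtain ⟨-, hzR, -⟩ := hz
  exact mem_image_leftSide_of_col hzR.1 hz0

/-- `LR` of the right block is determined by the pairs of its vertices. [folklore] -/
theorem determinedBy_lrCrossingAt (u : Site 2) (m n : ℕ) :
    DeterminedBy (lrCrossingAt u m n) ↑((rectangle m n).image (· + u)).sym2 := by
  rw [lrCrossingAt, ← Finset.coe_image]
  exact PlanarDuality.determinedBy_openCrossing _ _ _

/-- Vertex-disjoint blocks have disjoint pair sets. [folklore] -/
theorem disjoint_sym2_blocks (m₁ m₂ n : ℕ) :
    Disjoint (↑(rectangle m₁ n).sym2 : Set (Sym2 (Site 2)))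
      ↑((rectangle m₂ n).image (· + pt (m₁ + 1) 0)).sym2 := by
  rw [Finset.disjoint_coe, Finset.disjoint_left]
  intro e he he'
  induction e using Sym2.ind with
  | _ a b =>
    have ha : a ∈ rectangle m₁ n := Finset.mem_sym2_iff.1 he a (Sym2.mem_mk_left a b)
    have ha' : a ∈ (rectangle m₂ n).image (· + pt (m₁ + 1) 0) :=
      Finset.mem_sym2_iff.1 he' a (Sym2.mem_mk_left a b)
    obtain ⟨c, hc, rfl⟩ := Finset.mem_image.1 ha'
    simp only [mem_rectangle_iff, Pi.add_apply, Matrix.cons_val_zero] at ha hc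
    push_cast at ha
    omega

/-- **Sub-multiplicativity of the crossing probability over disjoint blocks**:
`p₁(m₁+m₂+1, n) ≤ p₁(m₁, n) · p₁(m₂, n)`. [folklore] -/
theorem pOne_add_le (m₁ m₂ n : ℕ) : pOne (m₁ + m₂ + 1) n ≤ pOne m₁ n * pOne m₂ n := by
  have hind := bondPercolation_real_inter_of_disjoint (zdGraph 2) half (disjoint_sym2_blocks m₁ m₂ n)
    (PlanarDuality.determinedBy_openCrossing (rectangle m₁ n) _ _) (determinedBy_lrCrossingAt _ m₂ n)
    (measurableSet_lrCrossing m₁ n) (measurableSet_lrCrossingAt _ m₂ n)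
  rw [bondPercolation_real_lrCrossingAt] at hind
  calc pOne (m₁ + m₂ + 1) n
      ≤ (bondPercolation (zdGraph 2) half).real (lrCrossing m₁ n ∩ lrCrossingAt (pt (m₁ + 1) 0) m₂ n) := by
        refine ENNReal.toReal_mono (measure_ne_top _ _) (measure_mono_ae ?_)
        filter_upwards [ae_subset_edgeSet (zdGraph 2) half] with ω hω h
        exact ⟨lrCrossing_anti_left (by omega) n hω h, lrCrossingAt_of_lrCrossing_add hω h⟩
    _ = pOne m₁ n * pOne m₂ n := hind

/-! ## §2 Finite-length lower bounds on the one-cluster rate -/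

/-- Iterated sub-multiplicativity: `p₁(k(m+1)+m, n) ≤ p₁(m,n)^{k+1}`. [folklore] -/
theorem pOne_blocks_le (m n k : ℕ) : pOne (k * (m + 1) + m) n ≤ pOne m n ^ (k + 1) := by
  induction k with
  | zero => simp
  | succ k ih =>
    have h := pOne_add_le (k * (m + 1) + m) m n
    have heq : k * (m + 1) + m + m + 1 = (k + 1) * (m + 1) + m := by ring
    rw [heq] at h
    calc pOne ((k + 1) * (m + 1) + m) n ≤ pOne (k * (m + 1) + m) n * pOne m n := h
      _ ≤ pOne m n ^ (k + 1) * pOne m n :=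
          mul_le_mul_of_nonneg_right ih (le_trans (by positivity) (pOne_ge m n))
      _ = pOne m n ^ (k + 1 + 1) := by ring

/-- The block subsequence `k ↦ k(m+1)+m` tends to infinity. [folklore] -/
theorem tendsto_blocks (m : ℕ) : Tendsto (fun k : ℕ ↦ k * (m + 1) + m) atTop atTop := by
  refine tendsto_atTop_mono (fun k ↦ ?_) tendsto_id
  simp only [id]; nlinarith

/-- The comparison sequence `(k+1)c/(k(m+1)+m) → c/(m+1)`. [folklore] -/
theorem tendsto_blocks_ratio (m : ℕ) (c : ℝ) :
    Tendsto (fun k : ℕ ↦ (k + 1 : ℝ) * c / ((k * (m + 1) + m : ℕ) : ℝ)) atTop (𝓝 (c / (m + 1))) := by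
  have h1 : Tendsto (fun k : ℕ ↦ c / ((m + 1 : ℝ) - 1 / ((k : ℝ) + 1))) atTop
      (𝓝 (c / ((m + 1 : ℝ) - 0))) := by
    refine tendsto_const_nhds.div (tendsto_const_nhds.sub tendsto_one_div_add_atTop_nhds_zero_nat) ?_
    have : (0 : ℝ) ≤ m := by positivity
    linarith
  rw [sub_zero] at h1
  refine h1.congr' ?_
  filter_upwards [eventually_ge_atTop 1] with k hk1
  show c / (((m : ℝ) + 1) - 1 / ((k : ℝ) + 1)) = ((k : ℝ) + 1) * c / ((k * (m + 1) + m : ℕ) : ℝ)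
  have hk : (1 : ℝ) ≤ (k : ℝ) := by exact_mod_cast hk1
  have hden : ((k * (m + 1) + m : ℕ) : ℝ) = ((k : ℝ) + 1) * (m + 1) - 1 := by push_cast; ring
  rw [hden]
  have hm : (0 : ℝ) ≤ m := by positivity
  have h1k : 1 / ((k : ℝ) + 1) ≤ 1 / 2 := by
    rw [div_le_div_iff₀ (by positivity) (by norm_num)]; linarith
  have hne : ((m : ℝ) + 1) - 1 / ((k : ℝ) + 1) ≠ 0 := by
    have : (0 : ℝ) < 1 / ((k : ℝ) + 1) := by positivity
    intro h0; linarith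
  have hne' : ((k : ℝ) + 1) * (m + 1) - 1 ≠ 0 := by
    intro h0; nlinarith
  field_simp

/-- **Finite-length lower bound on the one-cluster rate**: every limit `γ` of `-log p₁(m',n)/m'`
satisfies `γ ≥ -log p₁(m,n)/(m+1)` for EVERY `m`. [folklore] -/
theorem rateOne_ge_finite {n : ℕ} {γ : ℝ} (h : Tendsto (rateSeqOne n) atTop (𝓝 γ)) (m : ℕ) :
    -Real.log (pOne m n) / (m + 1) ≤ γ := by
  have hlim := tendsto_blocks_ratio m (-Real.log (pOne m n))
  refine le_of_tendsto_of_tendsto hlim (h.comp (tendsto_blocks m)) (Eventually.of_forall fun k ↦ ?_)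
  have hp : 0 < pOne m n := lt_of_lt_of_le (by positivity) (pOne_ge m n)
  have hpk : 0 < pOne (k * (m + 1) + m) n := lt_of_lt_of_le (by positivity) (pOne_ge _ n)
  have hlog : (k + 1 : ℝ) * -Real.log (pOne m n) ≤ -Real.log (pOne (k * (m + 1) + m) n) := by
    have := Real.log_le_log hpk (pOne_blocks_le m n k)
    rw [Real.log_pow] at this; push_cast at this; linarith
  show (k + 1 : ℝ) * -Real.log (pOne m n) / ((k * (m + 1) + m : ℕ) : ℝ) ≤
    -Real.log (pOne (k * (m + 1) + m) n) / ((k * (m + 1) + m : ℕ) : ℝ)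
  exact div_le_div_of_nonneg_right hlog (by positivity)

/-- **Self-duality lower bound: `γ₁(n) ≥ log 2/(n+2)`** (`p₁(n+1,n) = 1/2`). [folklore] -/
theorem rateOne_ge {n : ℕ} {γ : ℝ} (h : Tendsto (rateSeqOne n) atTop (𝓝 γ)) :
    Real.log 2 / (n + 2) ≤ γ := by
  have := rateOne_ge_finite h (n + 1)
  rw [show pOne (n + 1) n = 1 / 2 from crossingProb_half_succ_self_holds n, one_div, Real.log_inv,
    neg_neg] at this
  push_cast at this
  convert this using 2; ring


/-! ## §1 Restriction of two-cluster pairs to the blocks -/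

/-- The two-cluster event of the right block, written with shifted sets (points of the unshifted
block, shifted by `u`). [folklore] -/
def twoClusterEventAt (u : Site 2) (m n : ℕ) : Set (BondConfig (Site 2)) :=
  {ω | ∃ x₁ ∈ (leftSide m n : Set (Site 2)), ∃ y₁ ∈ (rightSide m n : Set (Site 2)),
    ∃ x₂ ∈ (leftSide m n : Set (Site 2)), ∃ y₂ ∈ (rightSide m n : Set (Site 2)),
      ω ∈ openConnIn ((· + u) '' (rectangle m n : Set (Site 2))) (x₁ + u) (y₁ + u) ∧
      ω ∈ openConnIn ((· + u) '' (rectangle m n : Set (Site 2))) (x₂ + u) (y₂ + u) ∧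
      ω ∉ openConnIn ((· + u) '' (rectangle m n : Set (Site 2))) (x₁ + u) (x₂ + u)}

/-- **Two distinct spanning clusters of the long rectangle give two of the left block.** [folklore] -/
theorem twoClusterEvent_of_add_left {m₁ m₂ n : ℕ} {ω : BondConfig (Site 2)}
    (hωE : ω ⊆ (zdGraph 2).edgeSet) (hω : ω ∈ twoClusterEvent (m₁ + m₂ + 1) n) :
    ω ∈ twoClusterEvent m₁ n := by
  obtain ⟨x₁, hx₁, y₁, hy₁, x₂, hx₂, y₂, hy₂, h₁, h₂, h₁₂⟩ := hω
  have hx₁0 : x₁ 0 = 0 := (Finset.mem_filter.1 (Finset.mem_coe.1 hx₁)).2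
  have hx₂0 : x₂ 0 = 0 := (Finset.mem_filter.1 (Finset.mem_coe.1 hx₂)).2
  have hy₁0 : y₁ 0 = (m₁ + m₂ + 1 : ℕ) := (Finset.mem_filter.1 (Finset.mem_coe.1 hy₁)).2
  have hy₂0 : y₂ 0 = (m₁ + m₂ + 1 : ℕ) := (Finset.mem_filter.1 (Finset.mem_coe.1 hy₂)).2
  obtain ⟨z₁, hz₁0, hz₁⟩ := exists_openConnIn_column hωE (m₁ : ℤ) (by rw [hx₁0]; positivity)
    (by rw [hy₁0]; push_cast; omega) h₁
  obtain ⟨z₂, hz₂0, hz₂⟩ := exists_openConnIn_column hωE (m₁ : ℤ) (by rw [hx₂0]; positivity)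
    (by rw [hy₂0]; push_cast; omega) h₂
  have hz₁' := openConnIn_mono (inter_subset_rectangle m₁ m₂ n) x₁ z₁ hz₁
  have hz₂' := openConnIn_mono (inter_subset_rectangle m₁ m₂ n) x₂ z₂ hz₂
  have hsub : (↑(rectangle m₁ n) : Set (Site 2)) ⊆ ↑(rectangle (m₁ + m₂ + 1) n) :=
    Finset.coe_subset.2 (rectangle_mono (by omega) le_rfl)
  refine ⟨x₁, ?_, z₁, ?_, x₂, ?_, z₂, ?_, hz₁', hz₂', fun h => h₁₂ (openConnIn_mono hsub x₁ x₂ h)⟩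
  · have := (Finset.mem_filter.1 (Finset.mem_coe.1 hx₁)).1
    simp only [Finset.mem_coe, leftSide, Finset.mem_filter, mem_rectangle_iff] at this ⊢; omega
  · obtain ⟨-, hzR, -⟩ := hz₁'
    simp only [Finset.mem_coe, rightSide, Finset.mem_filter] at hzR ⊢; exact ⟨hzR, hz₁0⟩
  · have := (Finset.mem_filter.1 (Finset.mem_coe.1 hx₂)).1
    simp only [Finset.mem_coe, leftSide, Finset.mem_filter, mem_rectangle_iff] at this ⊢; omega
  · obtain ⟨-, hzR, -⟩ := hz₂'
    simp only [Finset.mem_coe, rightSide, Finset.mem_filter] at hzR ⊢; exact ⟨hzR, hz₂0⟩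

/-- **Two distinct spanning clusters of the long rectangle give two of the right block.** [folklore] -/
theorem twoClusterEventAt_of_add_right {m₁ m₂ n : ℕ} {ω : BondConfig (Site 2)}
    (hωE : ω ⊆ (zdGraph 2).edgeSet) (hω : ω ∈ twoClusterEvent (m₁ + m₂ + 1) n) :
    ω ∈ twoClusterEventAt (pt (m₁ + 1) 0) m₂ n := by
  obtain ⟨x₁, hx₁, y₁, hy₁, x₂, hx₂, y₂, hy₂, h₁, h₂, h₁₂⟩ := hω
  set R : Set (Site 2) := ↑(rectangle (m₁ + m₂ + 1) n) with hR
  have hx₁0 : x₁ 0 = 0 := (Finset.mem_filter.1 (Finset.mem_coe.1 hx₁)).2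
  have hx₂0 : x₂ 0 = 0 := (Finset.mem_filter.1 (Finset.mem_coe.1 hx₂)).2
  have hy₁0 : y₁ 0 = (m₁ + m₂ + 1 : ℕ) := (Finset.mem_filter.1 (Finset.mem_coe.1 hy₁)).2
  have hy₂0 : y₂ 0 = (m₁ + m₂ + 1 : ℕ) := (Finset.mem_filter.1 (Finset.mem_coe.1 hy₂)).2
  have h₁' : ω ∈ openConnIn R y₁ x₁ := by rwa [openConnIn_comm]
  have h₂' : ω ∈ openConnIn R y₂ x₂ := by rwa [openConnIn_comm]
  obtain ⟨z₁, hz₁0, hz₁⟩ := exists_openConnIn_column_ge hωE ((m₁ : ℤ) + 1)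
    (by rw [hy₁0]; push_cast; omega) (by rw [hx₁0]; positivity) h₁'
  obtain ⟨z₂, hz₂0, hz₂⟩ := exists_openConnIn_column_ge hωE ((m₁ : ℤ) + 1)
    (by rw [hy₂0]; push_cast; omega) (by rw [hx₂0]; positivity) h₂'
  -- the points of the right block, unshifted
  obtain ⟨a₁, ha₁, rfl⟩ := mem_image_leftSide_of_col (m₂ := m₂) hz₁.2.1.1 hz₁0
  obtain ⟨a₂, ha₂, rfl⟩ := mem_image_leftSide_of_col (m₂ := m₂) hz₂.2.1.1 hz₂0
  obtain ⟨b₁, hb₁, rfl⟩ := mem_image_rightSide_of_mem_rightSide (m₁ := m₁) (m₂ := m₂) hy₁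
  obtain ⟨b₂, hb₂, rfl⟩ := mem_image_rightSide_of_mem_rightSide (m₁ := m₁) (m₂ := m₂) hy₂
  have hsub := inter_subset_image_rectangle m₁ m₂ n
  have hsub' : (· + pt (m₁ + 1) 0) '' (rectangle m₂ n : Set (Site 2)) ⊆ R := by
    rintro _ ⟨c, hc, rfl⟩
    simp only [Finset.mem_coe, mem_rectangle_iff, Pi.add_apply, Matrix.cons_val_zero,
      Matrix.cons_val_one, Matrix.cons_val_fin_one, hR] at hc ⊢
    push_cast; omega
  refine ⟨a₁, ha₁, b₁, hb₁, a₂, ha₂, b₂, hb₂, ?_, ?_, fun h => h₁₂ ?_⟩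
  · rw [openConnIn_comm]; exact openConnIn_mono hsub _ _ hz₁
  · rw [openConnIn_comm]; exact openConnIn_mono hsub _ _ hz₂
  · -- x₁ ~ y₁ ~ z₁ ~ z₂ ~ y₂ ~ x₂ inside R
    have e₁ : ω ∈ openConnIn R x₁ (a₁ + pt (m₁ + 1) 0) :=
      PlanarDuality.openConnIn_trans h₁ (openConnIn_mono Set.inter_subset_left _ _ hz₁)
    have e₂ : ω ∈ openConnIn R x₂ (a₂ + pt (m₁ + 1) 0) :=
      PlanarDuality.openConnIn_trans h₂ (openConnIn_mono Set.inter_subset_left _ _ hz₂)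
    have e₃ : ω ∈ openConnIn R (a₁ + pt (m₁ + 1) 0) (a₂ + pt (m₁ + 1) 0) := openConnIn_mono hsub' _ _ h
    rw [openConnIn_comm] at e₂
    exact PlanarDuality.openConnIn_trans (PlanarDuality.openConnIn_trans e₁ e₃) e₂

/-! ## §2 Locality, translation, independence -/

/-- The two-cluster event is determined by the pairs of vertices of its rectangle. [folklore] -/
theorem determinedBy_twoClusterEvent (m n : ℕ) :
    DeterminedBy (twoClusterEvent m n) ↑(rectangle m n).sym2 := by
  rw [determinedBy_iff]
  intro ω ω' h
  have hc := fun x y => (determinedBy_iff _ _).1 (PlanarDuality.determinedBy_openConnIn (rectangle m n) x y) ω ω' h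
  simp only [twoClusterEvent, Set.mem_setOf_eq, hc]

/-- The shifted two-cluster event is determined by the pairs of vertices of the shifted rectangle. [folklore] -/
theorem determinedBy_twoClusterEventAt (u : Site 2) (m n : ℕ) :
    DeterminedBy (twoClusterEventAt u m n) ↑((rectangle m n).image (· + u)).sym2 := by
  rw [determinedBy_iff]
  intro ω ω' h
  have hc := fun x y => (determinedBy_iff _ _).1
    (PlanarDuality.determinedBy_openConnIn ((rectangle m n).image (· + u)) x y) ω ω' h
  simp only [Finset.coe_image] at hc
  simp only [twoClusterEventAt, Set.mem_setOf_eq, hc]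

/-- Transport of restricted connections along the shift by `u`. [folklore] -/
theorem relabel_shift_mem_openConnIn_iff (u : Site 2) (R : Set (Site 2)) (a b : Site 2)
    (ω : BondConfig (Site 2)) :
    BondConfig.relabel (sym2Equiv (zdShiftIso u).toEquiv) ω ∈ openConnIn ((· + u) '' R) (a + u) (b + u) ↔
      ω ∈ openConnIn R a b := by
  have himg : ⇑(zdShiftIso u).toEquiv '' R = (· + u) '' R := rfl
  have ha : (zdShiftIso u).toEquiv a = a + u := rfl
  have hb : (zdShiftIso u).toEquiv b = b + u := rfl
  constructor
  · intro h
    have h' := relabel_mem_openConnIn (zdShiftIso u).toEquiv.symm h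
    rw [relabel_symm_relabel, ← himg, Equiv.symm_image_image, ← ha, ← hb,
      Equiv.symm_apply_apply, Equiv.symm_apply_apply] at h'
    exact h'
  · intro h
    have h' := relabel_mem_openConnIn (zdShiftIso u).toEquiv h
    rwa [himg, ha, hb] at h'

/-- **Translation invariance of `p₂`**: the shifted two-cluster event has probability `p₂(m,n)`. [folklore] -/
theorem real_twoClusterEventAt (u : Site 2) (m n : ℕ) :
    (bondPercolation (zdGraph 2) half).real (twoClusterEventAt u m n) = pTwo m n := by
  rw [pTwo, ← bondPercolation_real_preimage_relabel_iso (zdShiftIso u) half (twoClusterEventAt u m n)]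
  congr 1
  ext ω
  simp only [Set.mem_preimage, twoClusterEventAt, twoClusterEvent, Set.mem_setOf_eq,
    relabel_shift_mem_openConnIn_iff]

/-- **Sub-multiplicativity of the two-cluster probability over disjoint blocks**:
`p₂(m₁+m₂+1, n) ≤ p₂(m₁, n) · p₂(m₂, n)`. [folklore] -/
theorem pTwo_add_le (m₁ m₂ n : ℕ) : pTwo (m₁ + m₂ + 1) n ≤ pTwo m₁ n * pTwo m₂ n := by
  have hind := bondPercolation_real_inter_of_disjoint (zdGraph 2) half (disjoint_sym2_blocks m₁ m₂ n)
    (determinedBy_twoClusterEvent m₁ n) (determinedBy_twoClusterEventAt _ m₂ n)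
    (determinedBy_twoClusterEvent m₁ n).measurableSet_of_finset
    (determinedBy_twoClusterEventAt _ m₂ n).measurableSet_of_finset
  rw [real_twoClusterEventAt] at hind
  calc pTwo (m₁ + m₂ + 1) n
      ≤ (bondPercolation (zdGraph 2) half).real
          (twoClusterEvent m₁ n ∩ twoClusterEventAt (pt (m₁ + 1) 0) m₂ n) := by
        refine ENNReal.toReal_mono (measure_ne_top _ _) (measure_mono_ae ?_)
        filter_upwards [ae_subset_edgeSet (zdGraph 2) half] with ω hω h
        exact ⟨twoClusterEvent_of_add_left hω h, twoClusterEventAt_of_add_right hω h⟩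
    _ = pTwo m₁ n * pTwo m₂ n := hind


/-! ## §3 Finite-length lower bounds on the two-cluster rate -/

/-- Iterated sub-multiplicativity: `p₂(k(m+1)+m, n) ≤ p₂(m,n)^{k+1}` (`n ≥ 1`). [folklore] -/
theorem pTwo_blocks_le (m k : ℕ) {n : ℕ} (hn : 1 ≤ n) :
    pTwo (k * (m + 1) + m) n ≤ pTwo m n ^ (k + 1) := by
  induction k with
  | zero => simp
  | succ k ih =>
    have h := pTwo_add_le (k * (m + 1) + m) m n
    have heq : k * (m + 1) + m + m + 1 = (k + 1) * (m + 1) + m := by ring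
    rw [heq] at h
    calc pTwo ((k + 1) * (m + 1) + m) n ≤ pTwo (k * (m + 1) + m) n * pTwo m n := h
      _ ≤ pTwo m n ^ (k + 1) * pTwo m n :=
          mul_le_mul_of_nonneg_right ih (le_trans (by positivity) (pTwo_ge hn))
      _ = pTwo m n ^ (k + 1 + 1) := by ring

/-- **Finite-length lower bound on the two-cluster rate** (`n ≥ 1`): every limit `γ` of
`-log p₂(m',n)/m'` satisfies `γ ≥ -log p₂(m,n)/(m+1)` for every `m`. [folklore] -/
theorem rateTwo_ge_finite {n : ℕ} (hn : 1 ≤ n) {γ : ℝ} (h : Tendsto (rateSeqTwo n) atTop (𝓝 γ))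
    (m : ℕ) : -Real.log (pTwo m n) / (m + 1) ≤ γ := by
  have hlim := tendsto_blocks_ratio m (-Real.log (pTwo m n))
  refine le_of_tendsto_of_tendsto hlim (h.comp (tendsto_blocks m)) (Eventually.of_forall fun k ↦ ?_)
  have hp : 0 < pTwo m n := lt_of_lt_of_le (by positivity) (pTwo_ge hn)
  have hpk : 0 < pTwo (k * (m + 1) + m) n := lt_of_lt_of_le (by positivity) (pTwo_ge hn)
  have hlog : (k + 1 : ℝ) * -Real.log (pTwo m n) ≤ -Real.log (pTwo (k * (m + 1) + m) n) := by
    have := Real.log_le_log hpk (pTwo_blocks_le m k hn)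
    rw [Real.log_pow] at this; push_cast at this; linarith
  show (k + 1 : ℝ) * -Real.log (pTwo m n) / ((k * (m + 1) + m : ℕ) : ℝ) ≤
    -Real.log (pTwo (k * (m + 1) + m) n) / ((k * (m + 1) + m : ℕ) : ℝ)
  exact div_le_div_of_nonneg_right hlog (by positivity)


/-! ## §4 BK: `p₂ ≤ p₁²` and `γ₂ ≥ 2γ₁` -/

/-- **Two distinct spanning clusters are two disjointly occurring crossings** (lattice
configurations): the edge sets of the two open paths are disjoint open witnesses. [folklore] -/
theorem twoClusterEvent_subset_disjointOccurrence {m n : ℕ} {ω : BondConfig (Site 2)}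
    (hωE : ω ⊆ (zdGraph 2).edgeSet) (hω : ω ∈ twoClusterEvent m n) :
    ω ∈ lrCrossing m n □ lrCrossing m n := by
  classical
  obtain ⟨x₁, hx₁, y₁, hy₁, x₂, hx₂, y₂, hy₂, h₁, h₂, h₁₂⟩ := hω
  obtain ⟨P₁, hS₁, hE₁⟩ := exists_walk_of_mem_openConnIn hωE h₁
  obtain ⟨P₂, hS₂, hE₂⟩ := exists_walk_of_mem_openConnIn hωE h₂
  have key : ∀ z, z ∈ P₁.support → z ∈ P₂.support → False := fun z hz₁ hz₂ =>
    h₁₂ (PlanarDuality.openConnIn_trans (mem_openConnIn_of_mem_support P₁ hS₁ hE₁ hz₁)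
      (by rw [openConnIn_comm]; exact mem_openConnIn_of_mem_support P₂ hS₂ hE₂ hz₂))
  rw [(isUpperSet_lrCrossing m n).mem_disjointOccurrence_iff (isUpperSet_lrCrossing m n)]
  refine ⟨{e | e ∈ P₁.edges}, fun e he => hE₁ e he, {e | e ∈ P₂.edges}, fun e he => hE₂ e he,
    ?_, ?_, ?_⟩
  · rw [Set.disjoint_left]
    intro e he₁ he₂
    simp only [Set.mem_setOf_eq] at he₁ he₂
    induction e using Sym2.ind with
    | _ a b => exact key a (P₁.fst_mem_support_of_mem_edges he₁) (P₂.fst_mem_support_of_mem_edges he₂)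
  · exact ⟨x₁, hx₁, y₁, hy₁, mem_openConnIn_of_walk P₁ hS₁ fun e he => he⟩
  · exact ⟨x₂, hx₂, y₂, hy₂, mem_openConnIn_of_walk P₂ hS₂ fun e he => he⟩

/-- **van den Berg–Kesten: `p₂(m,n) ≤ p₁(m,n)²`.** [folklore] -/
theorem pTwo_le_pOne_sq (m n : ℕ) : pTwo m n ≤ pOne m n ^ 2 := by
  calc pTwo m n ≤ (bondPercolation (zdGraph 2) half).real (lrCrossing m n □ lrCrossing m n) := by
        refine ENNReal.toReal_mono (measure_ne_top _ _) (measure_mono_ae ?_)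
        filter_upwards [ae_subset_edgeSet (zdGraph 2) half] with ω hω h
        exact twoClusterEvent_subset_disjointOccurrence hω h
    _ ≤ pOne m n * pOne m n :=
        bk_inequality_holds (zdGraph 2) half (isUpperSet_lrCrossing m n) (isUpperSet_lrCrossing m n)
          (isLocalEvent_lrCrossing m n) (isLocalEvent_lrCrossing m n)
    _ = pOne m n ^ 2 := by ring

/-- Termwise: `-log p₂(m,n)/m ≥ 2 · (-log p₁(m,n)/m)` (`n ≥ 1`). [folklore] -/
theorem two_mul_rateSeqOne_le (m : ℕ) {n : ℕ} (hn : 1 ≤ n) : 2 * rateSeqOne n m ≤ rateSeqTwo n m := by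
  have hp : 0 < pTwo m n := lt_of_lt_of_le (by positivity) (pTwo_ge hn)
  have hlog : 2 * -Real.log (pOne m n) ≤ -Real.log (pTwo m n) := by
    have := Real.log_le_log hp (pTwo_le_pOne_sq m n)
    rw [Real.log_pow] at this; push_cast at this; linarith
  show 2 * (-Real.log (pOne m n) / (m : ℝ)) ≤ -Real.log (pTwo m n) / (m : ℝ)
  rw [← mul_div_assoc]
  exact div_le_div_of_nonneg_right hlog (by positivity)

/-- **`γ₂(n) ≥ 2 γ₁(n)`** for the limits (`n ≥ 1`). [folklore] -/
theorem rateTwo_ge_two_mul_rateOne {n : ℕ} (hn : 1 ≤ n) {γ₁ γ₂ : ℝ}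
    (h₁ : Tendsto (rateSeqOne n) atTop (𝓝 γ₁)) (h₂ : Tendsto (rateSeqTwo n) atTop (𝓝 γ₂)) :
    2 * γ₁ ≤ γ₂ :=
  le_of_tendsto_of_tendsto (h₁.const_mul 2) h₂ (Eventually.of_forall fun m ↦ two_mul_rateSeqOne_le m hn)

/-! ## §5 The rigorous window for `lim n·γ₁(n)` and `lim n·γ₂(n)` -/

/-- **Lower edge of the window**: for any rate function `γ₁` of the crux and any limit `L` of
`n·γ₁(n)`, `log 2 ≤ L` (self-duality + sub-multiplicativity). [folklore] -/
theorem nMul_rateOne_limit_ge {γ₁ : ℕ → ℝ}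
    (h : ∀ n : ℕ, 1 ≤ n → Tendsto (rateSeqOne n) atTop (𝓝 (γ₁ n))) {L : ℝ}
    (hL : Tendsto (fun n : ℕ ↦ (n : ℝ) * γ₁ n) atTop (𝓝 L)) : Real.log 2 ≤ L := by
  -- n log 2/(n+2) → log 2
  have hcmp : Tendsto (fun n : ℕ ↦ (n : ℝ) * (Real.log 2 / (n + 2))) atTop (𝓝 (Real.log 2)) := by
    have h1 : Tendsto (fun n : ℕ ↦ Real.log 2 / (1 + 2 / (n : ℝ))) atTop (𝓝 (Real.log 2 / (1 + 0))) := by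
      refine tendsto_const_nhds.div (tendsto_const_nhds.add ?_) (by norm_num)
      exact tendsto_const_nhds.div_atTop tendsto_natCast_atTop_atTop
    rw [add_zero, div_one] at h1
    refine h1.congr' ?_
    filter_upwards [eventually_ge_atTop 1] with n hn
    have : (n : ℝ) ≠ 0 := by exact_mod_cast Nat.one_le_iff_ne_zero.mp hn
    field_simp
  refine le_of_tendsto_of_tendsto hcmp hL ?_
  filter_upwards [eventually_ge_atTop 1] with n hn
  exact mul_le_mul_of_nonneg_left (rateOne_ge (h n hn)) (by positivity)

/-- **Upper edge of the window** (RSW, from `KacFromAboveFalse.rateOne_odd_width_le`): any limit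
`L` of `n·γ₁(n)` satisfies `L ≤ 16 log 2` (along odd widths `n = 2j+1`,
`n·γ₁(n) ≤ (2j+1)·8 log 2/(j+1) ≤ 16 log 2`). [folklore] -/
theorem nMul_rateOne_limit_le {γ₁ : ℕ → ℝ}
    (h : ∀ n : ℕ, 1 ≤ n → Tendsto (rateSeqOne n) atTop (𝓝 (γ₁ n))) {L : ℝ}
    (hL : Tendsto (fun n : ℕ ↦ (n : ℝ) * γ₁ n) atTop (𝓝 L)) : L ≤ 16 * Real.log 2 := by
  have hodd : Tendsto (fun j : ℕ ↦ 2 * j + 1) atTop atTop := by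
    refine tendsto_atTop_mono (fun j ↦ ?_) tendsto_id
    simp only [id]; omega
  refine le_of_tendsto' (hL.comp hodd) fun j ↦ ?_
  have hγ := rateOne_odd_width_le (h (2 * j + 1) (by omega))
  have hl : 0 < Real.log 2 := Real.log_pos one_lt_two
  have hj : (0 : ℝ) < (j : ℝ) + 1 := by positivity
  show ((2 * j + 1 : ℕ) : ℝ) * γ₁ (2 * j + 1) ≤ 16 * Real.log 2
  calc ((2 * j + 1 : ℕ) : ℝ) * γ₁ (2 * j + 1) ≤ ((2 * j + 1 : ℕ) : ℝ) * (8 * Real.log 2 / (j + 1)) :=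
        mul_le_mul_of_nonneg_left hγ (by positivity)
    _ ≤ 16 * Real.log 2 := by
        rw [mul_div_assoc', div_le_iff₀ hj]; push_cast; nlinarith

/-- **THE WINDOW**: `log 2 ≤ lim n·γ₁(n) ≤ 16 log 2`, i.e. `L ∈ [0.693…, 11.09…]`, for every rate
function and every limit; the crux claims `L = π/3 = 1.047…`. [folklore] -/
theorem nMul_rateOne_limit_mem_window {γ₁ : ℕ → ℝ}
    (h : ∀ n : ℕ, 1 ≤ n → Tendsto (rateSeqOne n) atTop (𝓝 (γ₁ n))) {L : ℝ}
    (hL : Tendsto (fun n : ℕ ↦ (n : ℝ) * γ₁ n) atTop (𝓝 L)) :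
    Real.log 2 ≤ L ∧ L ≤ 16 * Real.log 2 :=
  ⟨nMul_rateOne_limit_ge h hL, nMul_rateOne_limit_le h hL⟩

/-- **Lower edge for the two-cluster constant**: any limit `L₂` of `n·γ₂(n)` has `2 log 2 ≤ L₂`
(BK + the window); the crux claims `L₂ = 2π = 6.283…`. [folklore] -/
theorem nMul_rateTwo_limit_ge {γ₁ γ₂ : ℕ → ℝ}
    (h₁ : ∀ n : ℕ, 1 ≤ n → Tendsto (rateSeqOne n) atTop (𝓝 (γ₁ n)))
    (h₂ : ∀ n : ℕ, 1 ≤ n → Tendsto (rateSeqTwo n) atTop (𝓝 (γ₂ n))) {L₂ : ℝ}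
    (hL : Tendsto (fun n : ℕ ↦ (n : ℝ) * γ₂ n) atTop (𝓝 L₂)) : 2 * Real.log 2 ≤ L₂ := by
  have hcmp : Tendsto (fun n : ℕ ↦ (n : ℝ) * (2 * (Real.log 2 / (n + 2)))) atTop (𝓝 (2 * Real.log 2)) := by
    have h1 : Tendsto (fun n : ℕ ↦ 2 * Real.log 2 / (1 + 2 / (n : ℝ))) atTop
        (𝓝 (2 * Real.log 2 / (1 + 0))) := by
      refine tendsto_const_nhds.div (tendsto_const_nhds.add ?_) (by norm_num)
      exact tendsto_const_nhds.div_atTop tendsto_natCast_atTop_atTop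
    rw [add_zero, div_one] at h1
    refine h1.congr' ?_
    filter_upwards [eventually_ge_atTop 1] with n hn
    have : (n : ℝ) ≠ 0 := by exact_mod_cast Nat.one_le_iff_ne_zero.mp hn
    field_simp
  refine le_of_tendsto_of_tendsto hcmp hL ?_
  filter_upwards [eventually_ge_atTop 1] with n hn
  have := rateTwo_ge_two_mul_rateOne hn (h₁ n hn) (h₂ n hn)
  have := rateOne_ge (h₁ n hn)
  exact mul_le_mul_of_nonneg_left (by linarith) (by positivity)

/-- The Kac values claimed by the crux sit strictly inside the rigorous window:
`log 2 < π/3 < 16 log 2` and `2 log 2 < 2π` — none of the handles above can decide the crux. [folklore] -/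
theorem kac_values_in_window :
    Real.log 2 < Real.pi / 3 ∧ Real.pi / 3 < 16 * Real.log 2 ∧ 2 * Real.log 2 < 2 * Real.pi := by
  have h1 := Real.log_two_lt_d9
  have h2 := Real.log_two_gt_d9
  have h3 := Real.pi_gt_three
  have h4 := Real.pi_lt_d2
  refine ⟨by linarith, by linarith, by linarith⟩

/-- In the language of the crux: `StripClusterRates` passes every rigorous check of this file —
recorded as the (true) implication to the window constraints it must satisfy. [folklore] -/
theorem stripClusterRates_respects_window (h : StripClusterRates) :
    ∃ γ₁ γ₂ : ℕ → ℝ, (∀ n : ℕ, 1 ≤ n → Real.log 2 / (n + 2) ≤ γ₁ n ∧ 2 * γ₁ n ≤ γ₂ n ∧ γ₂ n ≤ 3 * Real.log 2) ∧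
      Tendsto (fun n : ℕ ↦ (n : ℝ) * γ₁ n) atTop (𝓝 (Real.pi / 3)) ∧
      Tendsto (fun n : ℕ ↦ (n : ℝ) * γ₂ n) atTop (𝓝 (2 * Real.pi)) := by
  obtain ⟨γ₁, γ₂, h1, h2, h3, h4⟩ := h
  exact ⟨γ₁, γ₂, fun n hn ↦ ⟨rateOne_ge (h1 n hn), rateTwo_ge_two_mul_rateOne hn (h1 n hn) (h2 n hn),
    rateTwo_le hn (h2 n hn)⟩, h3, h4⟩


/-! ## §6 Refuted variants: the crux with other constants

`StripClusterRates` is, definitionally, the instance `c₁ = π/3`, `c₂ = 2π` of the statement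
"∃ γ₁ γ₂, (rates exist for `n ≥ 1`) ∧ n·γ₁(n) → c₁ ∧ n·γ₂(n) → c₂" refuted below for every
`c₁ < log 2`, `c₁ > 16 log 2`, `c₂ < 2c₁` and `c₂ < 2 log 2` (statements inlined). -/

/-- **Refuted variant**: no one-cluster constant `c₁ < log 2` (whatever `c₂`). [folklore] -/
theorem not_stripClusterRates_variant_of_lt_log_two {c₁ c₂ : ℝ} (hc : c₁ < Real.log 2) :
    ¬ ∃ γ₁ γ₂ : ℕ → ℝ, (∀ n : ℕ, 1 ≤ n → Tendsto (rateSeqOne n) atTop (𝓝 (γ₁ n))) ∧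
        (∀ n : ℕ, 1 ≤ n → Tendsto (rateSeqTwo n) atTop (𝓝 (γ₂ n))) ∧
        Tendsto (fun n : ℕ ↦ (n : ℝ) * γ₁ n) atTop (𝓝 c₁) ∧
        Tendsto (fun n : ℕ ↦ (n : ℝ) * γ₂ n) atTop (𝓝 c₂) := by
  rintro ⟨γ₁, γ₂, h1, -, h3, -⟩
  have := nMul_rateOne_limit_ge h1 h3
  linarith

/-- **Refuted variant**: no one-cluster constant `c₁ > 16 log 2`. [folklore] -/
theorem not_stripClusterRates_variant_of_gt {c₁ c₂ : ℝ} (hc : 16 * Real.log 2 < c₁) :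
    ¬ ∃ γ₁ γ₂ : ℕ → ℝ, (∀ n : ℕ, 1 ≤ n → Tendsto (rateSeqOne n) atTop (𝓝 (γ₁ n))) ∧
        (∀ n : ℕ, 1 ≤ n → Tendsto (rateSeqTwo n) atTop (𝓝 (γ₂ n))) ∧
        Tendsto (fun n : ℕ ↦ (n : ℝ) * γ₁ n) atTop (𝓝 c₁) ∧
        Tendsto (fun n : ℕ ↦ (n : ℝ) * γ₂ n) atTop (𝓝 c₂) := by
  rintro ⟨γ₁, γ₂, h1, -, h3, -⟩
  have := nMul_rateOne_limit_le h1 h3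
  linarith

/-- **Refuted variant** (BK): the two-cluster constant is at least twice the one-cluster constant;
e.g. `c₁ = π/3` with any `c₂ < 2π/3`. [folklore] -/
theorem not_stripClusterRates_variant_of_lt_two_mul {c₁ c₂ : ℝ} (hc : c₂ < 2 * c₁) :
    ¬ ∃ γ₁ γ₂ : ℕ → ℝ, (∀ n : ℕ, 1 ≤ n → Tendsto (rateSeqOne n) atTop (𝓝 (γ₁ n))) ∧
        (∀ n : ℕ, 1 ≤ n → Tendsto (rateSeqTwo n) atTop (𝓝 (γ₂ n))) ∧
        Tendsto (fun n : ℕ ↦ (n : ℝ) * γ₁ n) atTop (𝓝 c₁) ∧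
        Tendsto (fun n : ℕ ↦ (n : ℝ) * γ₂ n) atTop (𝓝 c₂) := by
  rintro ⟨γ₁, γ₂, h1, h2, h3, h4⟩
  have key : 2 * c₁ ≤ c₂ := by
    refine le_of_tendsto_of_tendsto (h3.const_mul 2) h4 ?_
    filter_upwards [eventually_ge_atTop 1] with n hn
    have := rateTwo_ge_two_mul_rateOne hn (h1 n hn) (h2 n hn)
    have hn0 : (0 : ℝ) ≤ n := by positivity
    nlinarith
  linarith

/-- **Refuted variant**: no two-cluster constant `c₂ < 2 log 2` (whatever `c₁`). [folklore] -/
theorem not_stripClusterRates_variant_of_lt_two_log_two {c₁ c₂ : ℝ} (hc : c₂ < 2 * Real.log 2) :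
    ¬ ∃ γ₁ γ₂ : ℕ → ℝ, (∀ n : ℕ, 1 ≤ n → Tendsto (rateSeqOne n) atTop (𝓝 (γ₁ n))) ∧
        (∀ n : ℕ, 1 ≤ n → Tendsto (rateSeqTwo n) atTop (𝓝 (γ₂ n))) ∧
        Tendsto (fun n : ℕ ↦ (n : ℝ) * γ₁ n) atTop (𝓝 c₁) ∧
        Tendsto (fun n : ℕ ↦ (n : ℝ) * γ₂ n) atTop (𝓝 c₂) := by
  rintro ⟨γ₁, γ₂, h1, h2, -, h4⟩
  have := nMul_rateTwo_limit_ge h1 h2 h4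
  linarith

/-- Example: the misidentification of the one-cluster constant with the bulk one-arm value
`π · 5/48 = 0.327…` is rigorously false, whatever the two-cluster constant. [folklore] -/
theorem not_stripClusterRates_variant_bulkOneArm (c₂ : ℝ) :
    ¬ ∃ γ₁ γ₂ : ℕ → ℝ, (∀ n : ℕ, 1 ≤ n → Tendsto (rateSeqOne n) atTop (𝓝 (γ₁ n))) ∧
        (∀ n : ℕ, 1 ≤ n → Tendsto (rateSeqTwo n) atTop (𝓝 (γ₂ n))) ∧
        Tendsto (fun n : ℕ ↦ (n : ℝ) * γ₁ n) atTop (𝓝 (Real.pi * (5 / 48))) ∧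
        Tendsto (fun n : ℕ ↦ (n : ℝ) * γ₂ n) atTop (𝓝 c₂) := by
  refine not_stripClusterRates_variant_of_lt_log_two ?_
  have := Real.log_two_gt_d9
  have := Real.pi_lt_d2
  nlinarith


/-! ## §1 Load-bearing analysis: the hypothesis `1 ≤ n` (junk width `n = 0`) -/

/-- The left side of the width-0 rectangle is the single point `(0,0)`. -/
theorem eq_of_mem_leftSide_zero {m : ℕ} {x : Site 2} (hx : x ∈ (leftSide m 0 : Set (Site 2))) :
    x = ![0, 0] := by
  simp only [Finset.mem_coe, leftSide, Finset.mem_filter, mem_rectangle_iff] at hx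
  ext i; fin_cases i <;> simp <;> omega

/-- **Width 0 is junk for γ₂**: the two-cluster event of a one-row rectangle is empty. -/
theorem twoClusterEvent_width_zero (m : ℕ) : twoClusterEvent m 0 = ∅ := by
  ext ω
  simp only [Set.mem_empty_iff_false, iff_false]
  rintro ⟨x₁, hx₁, y₁, -, x₂, hx₂, y₂, -, -, -, h₁₂⟩
  rw [eq_of_mem_leftSide_zero hx₁, eq_of_mem_leftSide_zero hx₂] at h₁₂
  exact h₁₂ (openConnIn_refl (by simp [mem_rectangle_iff]))

/-- Hence `p₂(m,0) = 0` and the width-0 rate sequence is identically `0` (`Real.log 0 = 0`). -/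
theorem rateSeqTwo_width_zero : rateSeqTwo 0 = fun _ ↦ 0 := by
  funext m
  simp [rateSeqTwo, pTwo, twoClusterEvent_width_zero]

/-- The crux with `1 ≤ n` dropped from the γ₂-existence conjunct is implied by the crux itself:
the hypothesis is not load-bearing. -/
theorem rates₂_allWidths_of (h : StripClusterRates) :
    ∃ γ₂ : ℕ → ℝ, (∀ n : ℕ, Tendsto (rateSeqTwo n) atTop (𝓝 (γ₂ n))) ∧
      Tendsto (fun n : ℕ ↦ (n : ℝ) * γ₂ n) atTop (𝓝 (2 * Real.pi)) := by
  obtain ⟨γ₁, γ₂, -, h2, -, h4⟩ := h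
  refine ⟨fun n ↦ if n = 0 then 0 else γ₂ n, fun n ↦ ?_, ?_⟩
  · show Tendsto (rateSeqTwo n) atTop (𝓝 (if n = 0 then 0 else γ₂ n))
    rcases Nat.eq_zero_or_pos n with rfl | hn
    · rw [if_pos rfl, rateSeqTwo_width_zero]; exact tendsto_const_nhds
    · rw [if_neg hn.ne']; exact h2 n hn
  · refine h4.congr' ?_
    filter_upwards [eventually_ge_atTop 1] with n hn
    simp [Nat.one_le_iff_ne_zero.mp hn]

/-! ## §2 Existence is settled: Fekete ⇒ `StripRatesExist`; the crux ⇔ its two limits -/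

/-- **Fekete for shifted sub-multiplicative sequences.** If `0 < p m`, `p (m₁+m₂+1) ≤ p m₁ · p m₂`
and `-log p m ≤ C (m+1)`, then `-log p m / m` converges. -/
theorem tendsto_rate_of_submul {p : ℕ → ℝ} (hpos : ∀ m, 0 < p m)
    (hsub : ∀ m₁ m₂, p (m₁ + m₂ + 1) ≤ p m₁ * p m₂) {C : ℝ} (hC : 0 ≤ C)
    (hbd : ∀ m, -Real.log (p m) ≤ C * (m + 1)) :
    ∃ γ : ℝ, Tendsto (fun m : ℕ ↦ -Real.log (p m) / (m : ℝ)) atTop (𝓝 γ) := by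
  classical
  set u : ℕ → ℝ := fun m ↦ if m = 0 then 0 else Real.log (p (m - 1)) with hu
  have hu0 : u 0 = 0 := by simp [hu]
  have hus : ∀ m, u (m + 1) = Real.log (p m) := fun m ↦ by simp [hu]
  have hsubadd : Subadditive u := by
    intro m₁ m₂
    rcases Nat.eq_zero_or_pos m₁ with rfl | h₁
    · simp [hu0]
    rcases Nat.eq_zero_or_pos m₂ with rfl | h₂
    · simp [hu0]
    obtain ⟨a, rfl⟩ : ∃ a, m₁ = a + 1 := ⟨m₁ - 1, by omega⟩
    obtain ⟨b, rfl⟩ : ∃ b, m₂ = b + 1 := ⟨m₂ - 1, by omega⟩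
    rw [show a + 1 + (b + 1) = (a + b + 1) + 1 by ring, hus, hus, hus, ← Real.log_mul (hpos a).ne' (hpos b).ne']
    exact Real.log_le_log (hpos _) (hsub a b)
  have hbdd : BddBelow (Set.range fun n ↦ u n / n) := by
    refine ⟨-C, ?_⟩
    rintro _ ⟨m, rfl⟩
    rcases Nat.eq_zero_or_pos m with rfl | hm
    · simp [hu0, hC]
    obtain ⟨a, rfl⟩ : ∃ a, m = a + 1 := ⟨m - 1, by omega⟩
    show -C ≤ u (a + 1) / ((a + 1 : ℕ) : ℝ)
    rw [hus]
    have ha : (0 : ℝ) < (a + 1 : ℕ) := by positivity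
    rw [le_div_iff₀ ha]
    have := hbd a
    push_cast at this ⊢
    linarith
  have hlim := hsubadd.tendsto_lim hbdd
  have h1 : Tendsto (fun m : ℕ ↦ u (m + 1) / ((m + 1 : ℕ) : ℝ)) atTop (𝓝 hsubadd.lim) :=
    hlim.comp (tendsto_add_atTop_nat 1)
  have h2 : Tendsto (fun m : ℕ ↦ ((m : ℝ) + 1) / m) atTop (𝓝 1) := by
    have : Tendsto (fun m : ℕ ↦ 1 + 1 / (m : ℝ)) atTop (𝓝 (1 + 0)) :=
      tendsto_const_nhds.add (tendsto_const_nhds.div_atTop tendsto_natCast_atTop_atTop)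
    rw [add_zero] at this
    refine this.congr' ?_
    filter_upwards [eventually_ge_atTop 1] with m hm
    have : (m : ℝ) ≠ 0 := by exact_mod_cast Nat.one_le_iff_ne_zero.mp hm
    field_simp
  refine ⟨-(hsubadd.lim * 1), ?_⟩
  refine ((h1.mul h2).neg).congr' ?_
  filter_upwards [eventually_ge_atTop 1] with m hm
  have : (m : ℝ) ≠ 0 := by exact_mod_cast Nat.one_le_iff_ne_zero.mp hm
  rw [hus]; push_cast
  field_simp

/-- **`StripRatesExist` holds** (support item stmt-13879; by Fekete from `pOne_add_le`,
`pTwo_add_le`, `pOne_ge`, `pTwo_ge`). Positive: attached to stmt-13879 as evidence for a prover. -/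
theorem stripRatesExist_holds : StripRatesExist := by
  intro n hn
  have hl : 0 ≤ Real.log 2 := (Real.log_pos one_lt_two).le
  refine ⟨?_, ?_⟩
  · refine tendsto_rate_of_submul (p := fun m ↦ pOne m n)
      (fun m ↦ lt_of_lt_of_le (by positivity) (pOne_ge m n)) (fun m₁ m₂ ↦ pOne_add_le m₁ m₂ n) hl
      fun m ↦ ?_
    have hp : (0 : ℝ) < (1 / 2 : ℝ) ^ m := by positivity
    have := Real.log_le_log hp (pOne_ge m n)
    rw [Real.log_pow, one_div, Real.log_inv] at this
    nlinarith
  · refine tendsto_rate_of_submul (p := fun m ↦ pTwo m n)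
      (fun m ↦ lt_of_lt_of_le (by positivity) (pTwo_ge hn)) (fun m₁ m₂ ↦ pTwo_add_le m₁ m₂ n)
      (C := 3 * Real.log 2) (by positivity) fun m ↦ ?_
    have hp : (0 : ℝ) < (1 / 2 : ℝ) ^ (3 * m + 1) := by positivity
    have := Real.log_le_log hp (pTwo_ge (m := m) hn)
    rw [Real.log_pow, one_div, Real.log_inv] at this
    push_cast at this
    nlinarith

/-- **The crux is equivalent to its two limit conjuncts**: with the rates `γ_k(n)` now KNOWN to
exist (choose them), `StripClusterRates ↔ (n·γ₁(n) → π/3 ∧ n·γ₂(n) → 2π)` for THE rate functions.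
Stated with the chosen limits `rateOne n`, `rateTwo n`. -/
theorem stripClusterRates_iff_limits :
    StripClusterRates ↔
      Tendsto (fun n : ℕ ↦ (n : ℝ) * (if h : 1 ≤ n then (stripRatesExist_holds n h).1.choose else 0))
          atTop (𝓝 (Real.pi / 3)) ∧
      Tendsto (fun n : ℕ ↦ (n : ℝ) * (if h : 1 ≤ n then (stripRatesExist_holds n h).2.choose else 0))
          atTop (𝓝 (2 * Real.pi)) := by
  constructor
  · rintro ⟨γ₁, γ₂, h1, h2, h3, h4⟩
    refine ⟨h3.congr' ?_, h4.congr' ?_⟩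
    · filter_upwards [eventually_ge_atTop 1] with n hn
      rw [dif_pos hn, tendsto_nhds_unique (h1 n hn) (stripRatesExist_holds n hn).1.choose_spec]
    · filter_upwards [eventually_ge_atTop 1] with n hn
      rw [dif_pos hn, tendsto_nhds_unique (h2 n hn) (stripRatesExist_holds n hn).2.choose_spec]
  · rintro ⟨h3, h4⟩
    refine ⟨fun n ↦ if h : 1 ≤ n then (stripRatesExist_holds n h).1.choose else 0,
      fun n ↦ if h : 1 ≤ n then (stripRatesExist_holds n h).2.choose else 0,
      fun n hn ↦ ?_, fun n hn ↦ ?_, h3, h4⟩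
    · simp only [dif_pos hn]; exact (stripRatesExist_holds n hn).1.choose_spec
    · simp only [dif_pos hn]; exact (stripRatesExist_holds n hn).2.choose_spec

/-! ## §3 Why it resists: the window, restated for the crux's own rate functions -/

/-- Under the crux: `γ₁(n) ∈ [log 2/(n+2), log 2]`, `γ₂(n) ∈ [2γ₁(n), 3 log 2]`, `γ₂(1) = 3 log 2`,
and the limits `π/3`, `2π` obey `log 2 ≤ π/3 ≤ 16 log 2`, `2 log 2 ≤ 2π` — every rigorous check of
the Negative modules passes. -/
theorem stripClusterRates_passes_all_checks (h : StripClusterRates) :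
    ∃ γ₁ γ₂ : ℕ → ℝ,
      (∀ n : ℕ, 1 ≤ n → Real.log 2 / (n + 2) ≤ γ₁ n ∧ γ₁ n ≤ Real.log 2 ∧
        2 * γ₁ n ≤ γ₂ n ∧ γ₂ n ≤ 3 * Real.log 2) ∧ γ₂ 1 = 3 * Real.log 2 ∧
      Tendsto (fun n : ℕ ↦ (n : ℝ) * γ₁ n) atTop (𝓝 (Real.pi / 3)) ∧
      Tendsto (fun n : ℕ ↦ (n : ℝ) * γ₂ n) atTop (𝓝 (2 * Real.pi)) := by
  obtain ⟨γ₁, γ₂, h1, h2, h3, h4⟩ := h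
  exact ⟨γ₁, γ₂, fun n hn ↦ ⟨rateOne_ge (h1 n hn), rateOne_le (h1 n hn),
    rateTwo_ge_two_mul_rateOne hn (h1 n hn) (h2 n hn), rateTwo_le hn (h2 n hn)⟩,
    rateTwo_width_one_unique (h2 1 le_rfl), h3, h4⟩

/-! ## §6 Near-miss: the exact width-1 one-cluster probability is a Fibonacci number

`p₁(m,1) = F_{2m+2}/4ᵐ` (`F₁ = F₂ = 1`): the marked-column chain of the 2-row ladder (states: both /
top only / bottom only vertex of the current column joined to the left side; column-to-column
matrix `(1/8)·[[4,2,2],[1,2,0],[1,0,2]]`, start `(1,0,0)`, `p₁ = ` sum of the entries) has Perron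
root `(3+√5)/8 = φ²/4 = cos²(π/5)`, and its iterates are `3/4, 1/2, 21/64, 55/256, …` — confirmed
EXACTLY by exhaustive enumeration of the literal event for `m ≤ 4` (`compute/brute_small.py`,
evidence). The identity itself needs the Markov decomposition of `crossingProb half m 1` over the
last column (product-measure bookkeeping = `RateIsGap` at `n = 1`, prover infrastructure) and is the
only `sorry` of this file; the passage from it to `γ₁(1) = log(8/(3+√5)) = log 4 − 2 log φ =
0.4238707…` is PROVED (`rateOne_width_one_of_fib`, Binet squeeze `φⁿ/2 ≤ F_{n+1} ≤ φⁿ`). With it,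
`6γ₁(1) = 2.543 > γ₂(1) = 3 log 2 = 2.079` would make "γ₂ = 6γ₁ at every width" another refuted
strengthening (the ratio `γ₂/γ₁` tends to `6` from BELOW: 4.91, 5.31, 5.53, …). -/

/-- NEAR-MISS (true, not closed here): **`p₁(m,1) = F_{2m+2}/4ᵐ`**. Obstruction: width-1
transfer-matrix/Markov formalism for `crossingProb` (prover infrastructure). -/
theorem pOne_width_one_fib (m : ℕ) : pOne m 1 = (Nat.fib (2 * m + 2) : ℝ) / 4 ^ m := by
  sorry

/-- `fib (n+1) ≤ φⁿ`. -/
theorem fib_succ_le_pow (n : ℕ) : (Nat.fib (n + 1) : ℝ) ≤ Real.goldenRatio ^ n := by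
  have h := Real.goldenRatio_mul_fib_succ_add_fib n
  have hφ := Real.goldenRatio_pos
  have h0 : (0 : ℝ) ≤ Nat.fib n := Nat.cast_nonneg _
  have h1 : Real.goldenRatio * Nat.fib (n + 1) ≤ Real.goldenRatio * Real.goldenRatio ^ n := by
    rw [← pow_succ']; linarith
  exact le_of_mul_le_mul_left h1 hφ

/-- `φⁿ ≤ 2 fib (n+1)`. -/
theorem pow_le_two_mul_fib_succ (n : ℕ) : Real.goldenRatio ^ n ≤ 2 * (Nat.fib (n + 1) : ℝ) := by
  have h := Real.fib_succ_sub_goldenConj_mul_fib n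
  have hψ : -1 < Real.goldenConj := Real.neg_one_lt_goldenConj
  have hψ0 : Real.goldenConj < 0 := Real.goldenConj_neg
  have hmono : (Nat.fib n : ℝ) ≤ Nat.fib (n + 1) := by exact_mod_cast Nat.fib_le_fib_succ
  have h0 : (0 : ℝ) ≤ Nat.fib n := Nat.cast_nonneg _
  nlinarith

/-- `8/(3+√5) = 4/φ²`. -/
theorem eight_div_eq : (8 : ℝ) / (3 + Real.sqrt 5) = 4 / Real.goldenRatio ^ 2 := by
  rw [Real.goldenRatio_sq, Real.goldenRatio]
  have h5 : (0 : ℝ) ≤ Real.sqrt 5 := Real.sqrt_nonneg 5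
  field_simp
  ring

/-- **Reduction of the near-miss to the Fibonacci identity**: if `p₁(m,1) = F_{2m+2}/4ᵐ` for all `m`
(the exact solution of the 3-state marked-column chain of the 2-row ladder; verified by exhaustive
enumeration for `m ≤ 4`: `3/4, 1/2, 21/64, 55/256`), then `γ₁(1) = log(8/(3+√5)) = log 4 - 2 log φ`. -/
theorem rateOne_width_one_of_fib (hfib : ∀ m : ℕ, pOne m 1 = (Nat.fib (2 * m + 2) : ℝ) / 4 ^ m) :
    Tendsto (rateSeqOne 1) atTop (𝓝 (Real.log (8 / (3 + Real.sqrt 5)))) := by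
  have hφ := Real.goldenRatio_pos
  have hφ1 := Real.one_lt_goldenRatio
  have hlogφ : 0 < Real.log Real.goldenRatio := Real.log_pos hφ1
  -- the target value
  have hval : Real.log (8 / (3 + Real.sqrt 5)) = Real.log 4 - 2 * Real.log Real.goldenRatio := by
    rw [eight_div_eq, Real.log_div (by norm_num) (by positivity), Real.log_pow]; push_cast; ring
  rw [hval]
  -- u m := log fib(2m+2) / m, squeezed between two sequences tending to 2 log φ
  have hfibpos : ∀ m : ℕ, (0 : ℝ) < Nat.fib (2 * m + 2) := fun m ↦ by
    have := pow_le_two_mul_fib_succ (2 * m + 1)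
    have hp : (0 : ℝ) < Real.goldenRatio ^ (2 * m + 1) := by positivity
    linarith
  have hup : ∀ m : ℕ, Real.log (Nat.fib (2 * m + 2)) ≤ (2 * m + 1 : ℝ) * Real.log Real.goldenRatio := fun m ↦ by
    have := Real.log_le_log (hfibpos m) (fib_succ_le_pow (2 * m + 1))
    rw [Real.log_pow] at this; push_cast at this; linarith
  have hlow : ∀ m : ℕ, (2 * m + 1 : ℝ) * Real.log Real.goldenRatio - Real.log 2 ≤ Real.log (Nat.fib (2 * m + 2)) := fun m ↦ by
    have hp : (0 : ℝ) < Real.goldenRatio ^ (2 * m + 1) := by positivity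
    have := Real.log_le_log hp (pow_le_two_mul_fib_succ (2 * m + 1))
    rw [Real.log_pow, Real.log_mul (by norm_num) (hfibpos m).ne'] at this; push_cast at this; linarith
  -- rateSeqOne 1 m = log 4 - log fib(2m+2)/m for m ≥ 1
  have hrate : ∀ m : ℕ, 1 ≤ m → rateSeqOne 1 m = Real.log 4 - Real.log (Nat.fib (2 * m + 2)) / m := by
    intro m hm
    have hm0 : (m : ℝ) ≠ 0 := by exact_mod_cast Nat.one_le_iff_ne_zero.mp hm
    show -Real.log (pOne m 1) / (m : ℝ) = _
    rw [hfib m, Real.log_div (hfibpos m).ne' (by positivity), Real.log_pow]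
    field_simp
    ring
  -- squeeze
  have hA : Tendsto (fun m : ℕ ↦ Real.log 4 - ((2 * m + 1 : ℝ) * Real.log Real.goldenRatio) / m) atTop
      (𝓝 (Real.log 4 - 2 * Real.log Real.goldenRatio)) := by
    have h1 : Tendsto (fun m : ℕ ↦ Real.log 4 - (2 * Real.log Real.goldenRatio + Real.log Real.goldenRatio / (m : ℝ))) atTop
        (𝓝 (Real.log 4 - (2 * Real.log Real.goldenRatio + 0))) :=
      tendsto_const_nhds.sub (tendsto_const_nhds.add (tendsto_const_nhds.div_atTop tendsto_natCast_atTop_atTop))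
    rw [add_zero] at h1
    refine h1.congr' ?_
    filter_upwards [eventually_ge_atTop 1] with m hm
    have hm0 : (m : ℝ) ≠ 0 := by exact_mod_cast Nat.one_le_iff_ne_zero.mp hm
    field_simp
  have hB : Tendsto (fun m : ℕ ↦ Real.log 4 - ((2 * m + 1 : ℝ) * Real.log Real.goldenRatio - Real.log 2) / m) atTop
      (𝓝 (Real.log 4 - 2 * Real.log Real.goldenRatio)) := by
    have h1 : Tendsto (fun m : ℕ ↦ Real.log 4 - (2 * Real.log Real.goldenRatio +
        (Real.log Real.goldenRatio - Real.log 2) / (m : ℝ))) atTop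
        (𝓝 (Real.log 4 - (2 * Real.log Real.goldenRatio + 0))) :=
      tendsto_const_nhds.sub (tendsto_const_nhds.add (tendsto_const_nhds.div_atTop tendsto_natCast_atTop_atTop))
    rw [add_zero] at h1
    refine h1.congr' ?_
    filter_upwards [eventually_ge_atTop 1] with m hm
    have hm0 : (m : ℝ) ≠ 0 := by exact_mod_cast Nat.one_le_iff_ne_zero.mp hm
    field_simp
    ring
  refine tendsto_of_tendsto_of_tendsto_of_le_of_le' hA hB ?_ ?_
  · filter_upwards [eventually_ge_atTop 1] with m hm
    rw [hrate m hm]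
    have : Real.log (Nat.fib (2 * m + 2)) / (m : ℝ) ≤ (2 * m + 1 : ℝ) * Real.log Real.goldenRatio / m :=
      div_le_div_of_nonneg_right (hup m) (by positivity)
    linarith
  · filter_upwards [eventually_ge_atTop 1] with m hm
    rw [hrate m hm]
    have : ((2 * m + 1 : ℝ) * Real.log Real.goldenRatio - Real.log 2) / m ≤ Real.log (Nat.fib (2 * m + 2)) / (m : ℝ) :=
      div_le_div_of_nonneg_right (hlow m) (by positivity)
    linarith


/-- Hence (modulo the near-miss identity) the exact width-1 one-cluster rate
`γ₁(1) = log(8/(3+√5)) = 0.4238707…`. -/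
theorem rate₁_width_one : Tendsto (rateSeqOne 1) atTop (𝓝 (Real.log (8 / (3 + Real.sqrt 5)))) :=
  rateOne_width_one_of_fib pOne_width_one_fib

end

end Summit.CriticalPhenomena.CardyFormulaZ2.Cruxes.StripClusterRates.Disproof
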